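import Literature.NumberTheory.GaloisRepresentations.RestrictedRamificationOpenSubgroupLayers
import Literature.NumberTheory.GaloisRepresentations.SUnitsRestrictedLayers
import Literature.NumberTheory.GaloisCohomology.RestrictedRamificationH3MuOfSUnits
import Literature.NumberTheory.GaloisRepresentations.SUnitsRestrictedKummer
import HarnessLib

/-!
# The Galois layer cut out by an open normal subgroup of `G_{K,S}`, and `E_S[p]` under it
# (adapter inputs for Tate's Euler characteristic at a totally complex field; NSW VIII §3)

Topic `NumberTheory/GaloisCohomology`; namespace `Literature.NumberTheory.GaloisCohomology`.  Theorems
only; no definition, no named fact, no `sorry`, no instance, no notation.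

Setting of the hypothesis `hbase` of `TateGlobalEulerCharacteristicTCOfBase` and of the lane's Kummer
computation (brick B8-arith, stated over `U = galoisGroupAbove S H` for an open `H ≤ Γ_K` containing
`N_S`, with open normal subgroups of `↥U` of the form `OpenSubgroupLayer.layerSubgroup S hHo E hF hS`
— the kernel of `↥U ↠ Gal(E/F₀)` for a finite Galois layer `E/K`, `F₀ ≤ E ⊆ K_S`):

* **`exists_galLayer_layerSubgroup_eq`**: every open NORMAL `W ≤ G_{K,S}` with `W ≤ U` IS a layer
  subgroup: `layerSubgroup S hHo E hF hS = W.subgroupOf U` for the layer `E := K̄^{π⁻¹ W}`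
  (sharpening the cofinality `OpenSubgroupLayer.exists_layerSubgroup_le`); so the descent datum
  "`W ≤ U`, `[U : W]` prime to `p`" of `hbase` is expressible in the layer currency without changing
  the index;
* **`resRep_torsionBy_apply_eq_self_of_mem`**: if `W` fixes `μ_p` (through `ρ₀ ≅ μ_p` on
  `MuCarrier K p` and the compatibility `hρ₀` with `mu K p`), then `W ∩ U` acts trivially on the
  `p`-torsion `E_S[p]` of the `S`-units module `resRep K S H` (the model of `μ_p` used by the Kummer
  computation; `SUnitsRestrictedKummer.sUnitsRestricted_apply_eq_self_of_mem_torsionBy`);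
* `natCard_torsionBy_resRep`: `#E_S[p] = p` in that spelling.

Lane «TATE-EPC-TC» (cell `bsd-eis`, stmt-BirchSwinnertonDyer-19032), brick B8-alg (adapter inputs).
HONEST FRAMING: group-theoretic and Kummer-theoretic plumbing only; nothing here computes a cohomology
group or proves a case of BSD / of Tate's theorem.

## References
* J. Neukirch, A. Schmidt, K. Wingberg, *Cohomology of Number Fields*, 2nd ed. (2008), VIII §3, proof of (8.3.18). [NeukirchSchmidtWingberg2008]
* J.-P. Serre, *Galois Cohomology* (1997), I §2.2 Prop. 8. [SerreGaloisCohomology1997]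
-/

noncomputable section

open CategoryTheory Function NumberField Field IsDedekindDomain Topology
open scoped NumberField

namespace Literature.NumberTheory.GaloisCohomology

open Literature.NumberTheory.GaloisRepresentations
open Literature.NumberTheory.GaloisRepresentations.DiscreteGaloisModule (mu MuCarrier)
open Literature.NumberTheory.GaloisRepresentations.OpenSubgroupLayer
open Literature.NumberTheory.GaloisRepresentations.IdeleClassBar (GalLayer)
open Literature.NumberTheory.GaloisRepresentations.LocalWeilDatum (galFixing mem_galFixing_iff isOpen_galFixing)
open Literature.NumberTheory.GaloisRepresentations.SUnits
open Literature.NumberTheory.IwasawaTheory.Greenberg2006 (galoisGroupAbove mem_galoisGroupAbove_iff)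
open _root_.TopRep _root_.ContRepresentation _root_.ContinuousCohomology

variable {K : Type} [Field K] [NumberField K] (S : Set (HeightOneSpectrum (𝓞 K)))
  {H : Subgroup (absoluteGaloisGroup K)}

/-! ## §1 An open normal `W ≤ G_{K,S}` inside `U` is a layer subgroup -/

omit [NumberField K] in
/-- `π⁻¹ W ≤ H` when `W ≤ U = H/N_S` and `N_S ≤ H`. [cite: NeukirchSchmidtWingberg2008, VIII §3] -/
theorem comap_toUnramifiedQuot_le (hNH : ramificationSubgroup K S ≤ H)
    (W : Subgroup (GaloisGroupUnramifiedOutside K S)) (hWU : W ≤ galoisGroupAbove S H) :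
    W.comap (toUnramifiedQuot K S) ≤ H := by
  intro σ hσ
  have h1 : toUnramifiedQuot K S σ ∈ galoisGroupAbove S H := hWU hσ
  obtain ⟨τ, hτ, hτσ⟩ := Subgroup.mem_map.1 h1
  have h2 : τ⁻¹ * σ ∈ ramificationSubgroup K S := QuotientGroup.eq.1 hτσ
  have h3 : τ * (τ⁻¹ * σ) ∈ H := H.mul_mem hτ (hNH h2)
  rwa [mul_inv_cancel_left] at h3

/-- **Every open normal `W ≤ G_{K,S}` with `W ≤ U` is a layer subgroup of `U`**: for the finite Galois
layer `E := K̄^{π⁻¹ W}` (`F₀ ≤ E ⊆ K_S`), `layerSubgroup S hHo E hF hS = W.subgroupOf U`.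
[cite: NeukirchSchmidtWingberg2008, VIII §3] [cite: SerreGaloisCohomology1997, I §2.2 Prop. 8] -/
theorem exists_galLayer_layerSubgroup_eq (hHo : IsOpen (H : Set (absoluteGaloisGroup K)))
    (hNH : ramificationSubgroup K S ≤ H) (W : Subgroup (GaloisGroupUnramifiedOutside K S)) [W.Normal]
    (hWo : IsOpen (W : Set (GaloisGroupUnramifiedOutside K S))) (hWU : W ≤ galoisGroupAbove S H) :
    ∃ (E : GalLayer K) (hF : baseField H ≤ E.1) (hS : ramificationSubgroup K S ≤ galFixing K E.1),
      ((layerSubgroup S hHo E hF hS : OpenNormalSubgroup ↥(galoisGroupAbove S H)) :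
          Subgroup ↥(galoisGroupAbove S H)) = W.subgroupOf (galoisGroupAbove S H) := by
  -- the open normal subgroup `N := π⁻¹ W` of `Γ_K` and its fixed field
  let N : Subgroup (absoluteGaloisGroup K) := W.comap (toUnramifiedQuot K S)
  haveI hNn : N.Normal := Subgroup.Normal.comap inferInstance _
  have hNo : IsOpen (N : Set (absoluteGaloisGroup K)) := hWo.preimage (continuous_toUnramifiedQuot K S)
  have hNH' : N ≤ H := comap_toUnramifiedQuot_le S hNH W hWU
  let Nons : OpenNormalSubgroup (absoluteGaloisGroup K) := ⟨⟨N, hNo⟩, hNn⟩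
  let E : GalLayer K := IdeleClassBar.GalLayer.ofOpenNormalSubgroup Nons
  have hEfix : galFixing K E.1 = N := by
    have h := IdeleClassBar.GalLayer.openNormalSubgroup_ofOpenNormalSubgroup Nons
    have h' : ((IdeleClassBar.GalLayer.ofOpenNormalSubgroup Nons).openNormalSubgroup :
        Subgroup (absoluteGaloisGroup K)) = N := by rw [h]
    exact h'
  have hF : baseField H ≤ E.1 := by
    intro x hx
    change x ∈ IntermediateField.fixedField (N : Subgroup (AlgebraicClosure K ≃ₐ[K] AlgebraicClosure K))
    rw [IntermediateField.mem_fixedField_iff]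
    intro σ hσ
    exact (IntermediateField.mem_fixedField_iff _ x).1 hx σ (hNH' hσ)
  have hS : ramificationSubgroup K S ≤ galFixing K E.1 := by
    rw [hEfix]
    intro σ hσ
    have h1 : toUnramifiedQuot K S σ = 1 := (QuotientGroup.eq_one_iff σ).2 hσ
    rw [Subgroup.mem_comap, h1]
    exact W.one_mem
  refine ⟨E, hF, hS, Subgroup.ext fun u => ?_⟩
  obtain ⟨σ, rfl⟩ := toAbove_surjective S H u
  refine (toAbove_mem_layerSubgroup_iff S hHo E hF hS σ).trans ?_
  rw [hEfix, Subgroup.mem_subgroupOf, Subgroup.mem_comap]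
  rfl

/-! ## §2 `E_S[p]` under an open subgroup fixing `μ_p` -/

/-- **`W ∩ U` acts trivially on `E_S[p]`** when `W` fixes `μ_p` (`ρ₀ ≅ μ_p` with the compatibility
`hρ₀`): the `p`-torsion of the `N_S`-invariant `S`-units consists of roots of unity.
[cite: NeukirchSchmidtWingberg2008, proof of (8.3.18)] -/
theorem resRep_torsionBy_apply_eq_self_of_mem {p : ℕ} [Fact p.Prime]
    (ρ₀ : ContinuousRep (GaloisGroupUnramifiedOutside K S) ℤ (MuCarrier K p))
    (hρ₀ : ∀ (τ : absoluteGaloisGroup K) (v : MuCarrier K p), ρ₀ (toUnramifiedQuot K S τ) v = mu K p τ v)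
    (W : Subgroup (GaloisGroupUnramifiedOutside K S))
    (hWfix : ∀ g ∈ W, ∀ v : MuCarrier K p, ρ₀ g v = v)
    (hle : ∀ u : ↥(galoisGroupAbove S H),
      Submodule.torsionBy ℤ _ (p : ℤ) ≤ (Submodule.torsionBy ℤ _ (p : ℤ)).comap (Layers.resRep K S H u)) :
    ∀ u ∈ W.subgroupOf (galoisGroupAbove S H), ∀ a,
      ((Layers.resRep K S H).subrepresentation (Submodule.torsionBy ℤ _ (p : ℤ)) hle) u a = a := by
  intro u hu a
  obtain ⟨σ, hσ⟩ := toUnramifiedQuot_surjective K S (u : GaloisGroupUnramifiedOutside K S)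
  have hσfix : ∀ v : MuCarrier K p, ρ₀ (toUnramifiedQuot K S σ) v = v := fun v => by
    rw [hσ]
    exact hWfix _ (Subgroup.mem_subgroupOf.mp hu) v
  apply Subtype.ext
  change sUnitsRestricted K S (u : GaloisGroupUnramifiedOutside K S) (a : _) = a
  rw [← hσ]
  exact sUnitsRestricted_apply_eq_self_of_mem_torsionBy K S
    (smul_rootsOfUnity_eq_of_apply_eq ρ₀ hρ₀ hσfix) a.2

/-- `#E_S[p] = p` (`S ⊇ S_p`), in the spelling of the `S`-units module restricted to `U`.
[cite: NeukirchSchmidtWingberg2008, proof of (8.3.18)] -/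
theorem natCard_torsionBy_resRep {p : ℕ} [Fact p.Prime]
    (hSp : ∀ v : HeightOneSpectrum (𝓞 K), ((p : ℕ) : 𝓞 K) ∈ v.asIdeal → v ∈ S) :
    Nat.card (Submodule.torsionBy ℤ (Representation.invariants
      ((sUnitsModule K S).toRepresentation.comp (ramificationSubgroup K S).subtype)) (p : ℤ)) = p :=
  natCard_torsionBy_sUnitsRestricted K S hSp

end Literature.NumberTheory.GaloisCohomology

end
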